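import Summits.AtomisticToContinuum.HydrodynamicLimit.Theorems.InformationPercolationEngineCollisionRate
import Summits.AtomisticToContinuum.HydrodynamicLimit.Theorems.InformationPercolationEngineCollisionRateTubeRegular
import Summits.AtomisticToContinuum.HydrodynamicLimit.Theorems.InformationPercolationEngineCollisionRateUnitMarkTruncationRung0
import Summits.AtomisticToContinuum.HydrodynamicLimit.Theorems.InformationPercolationEngineCollisionRateCylinderPullbackUnitRung0
import Summits.AtomisticToContinuum.HydrodynamicLimit.Theorems.InformationPercolationEngineCollisionRateMeanEnskogUnitRung0
import Summits.AtomisticToContinuum.HydrodynamicLimit.Theorems.InformationPercolationEngineCollisionRateFixedTimeVarianceUnitRung0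
import Summits.AtomisticToContinuum.HydrodynamicLimit.Theorems.InformationPercolationEngineCollisionRateRung0
import Summits.AtomisticToContinuum.HydrodynamicLimit.Theorems.JParityClosureEvenStressEnskogL2ToProbability
import Summits.AtomisticToContinuum.HydrodynamicLimit.Theorems.OneFlightGossipEngineCollisionActivityTailsAbnormalActivityStatics
import Literature.MathematicalPhysics.KineticTheory.EvenCollisionTubeFunctional
import Literature.Analysis.FluidPDE.HardSphereCollisionRecord
import Literature.MathematicalPhysics.KineticTheory.CollisionFluxMeanBoundNonStationary
import Literature.MathematicalPhysics.KineticTheory.CollisionFluxUpperBound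
import Literature.MathematicalPhysics.KineticTheory.ShortFlightCount
import Literature.MathematicalPhysics.KineticTheory.CollisionTubePullbackDefs
import HarnessLib

/-!
# R34 · the time-integrated `L¹` smallness of the even tube functional at rung 0, unit mark
# (`stub_evenTubeStatL1Rung0`, line `Sketch`, crux `InformationPercolationEngine.CollisionRate`,
# stmt-AtomisticToContinuum-13481)

RUNG 0 = constant profiles `(a, u, θ)`: the local Gibbs law is the homogeneous canonical Gibbs law `G_N`,
invariant under every hard-sphere flow (`Theorems.integral_comp_flow_localGibbsLaw_const`).  For the even tube
functional `W_t = A_t − σ³ e_t` at the speed-truncated unit mark `Ξ₁ᴸ(n, v, w) = ψ_L(‖w − v‖)` we bound, at each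
fixed `t ∈ [0, τ]`,

  `E_{G_N}|W_t ∘ Φ_t| ≤ |E_{G_N}(W_t ∘ Φ_t)| + √Var_{G_N}(W_t ∘ Φ_t)`

(`integral_abs_le_abs_integral_add_sqrt_variance`: `|X| ≤ |X − EX| + |EX|` and Cauchy–Schwarz).  The variance is
at most `(η/(4τ))²` uniformly on `[0, τ]` for `N ≥ N₀` by the landed static assembly
`fixedTimeVariance_unit_rung0_of_static (tubeVariance_unit_rung0_of_plateauWindow (plateauWindow_of_twoCluster_labelLaw
vcan_append_sub_mul_le integral_labelLaw_eq_integral_mul_vcan)) enskogRateVariance_unit_rung0` (as in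
`collisionRateRung0`).  The mean is static (`E(W_t ∘ Φ_t) = E W_t = E A_t − σ³ E e_t`) and is controlled
POINTWISE in `t` exactly as inside the proof of R3 `stub_meanEnskogUnitRung0`: the tube side
`|E A_t − σ³ g(σ³) Y(σ³) Θ̄ ∫χ(t,·)| ≤ η/(4τ)` uniformly on `[0, τ]`
(`Literature.….forall_abs_integral_tubeStat_sub_le_of_contact` on the tree contact theorem), the Enskog side
`E e_t → g(σ³) Y(σ³) Θ̄ ∫χ(t,·)` pointwise in `t` with a uniform bound (`Literature.….tendsto_integral_enskogRate_rung0_of_psi`),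
whence `∫₀^τ |E e_t − g Y Θ̄ ∫χ| dt → 0` by dominated convergence.  Integrating in `t`:
`∫₀^τ E|W_t ∘ Φ_t| dt ≤ η/4 + η/4 + η/4 ≤ η`.
-/

open scoped BigOperators Topology Classical MeasureTheory ProbabilityTheory InnerProductSpace ENNReal
open Filter Set Function MeasureTheory
open Literature.Analysis.FluidPDE Literature.MathematicalPhysics.KineticTheory

namespace Summit.AtomisticToContinuum.HydrodynamicLimit.Theorems.CollisionRate

open Summit.AtomisticToContinuum.HydrodynamicLimit.Theorems.EvenStressEnskog

/-- **`E|X| ≤ |E X| + √Var X`** on a probability space, for a bounded a.e.-strongly measurable real observable: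
`|X| ≤ |X − EX| + |EX|` pointwise, and Cauchy–Schwarz `(E|X − EX|)² ≤ E(X − EX)² = Var X` in the form
`0 ≤ Var|X − EX|`. [folklore] -/
theorem integral_abs_le_abs_integral_add_sqrt_variance {Ω : Type*} [MeasurableSpace Ω] {μ : Measure Ω}
    [IsProbabilityMeasure μ] {X : Ω → ℝ} (hX : AEStronglyMeasurable X μ) {B : ℝ} (hB : ∀ ω, |X ω| ≤ B) :
    ∫ ω, |X ω| ∂μ ≤ |∫ ω, X ω ∂μ| + Real.sqrt (ProbabilityTheory.variance X μ) := by
  -- adapted from `Theorems.LGFS.sq_integral_abs_le_of_memLp` (BoxDissipativeWeakStrongLocalGibbsFineScaleCgibbs)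
  have hXi : Integrable X μ :=
    Integrable.of_bound hX B (Eventually.of_forall fun ω => by rw [Real.norm_eq_abs]; exact hB ω)
  have hYm : AEStronglyMeasurable (fun ω => X ω - ∫ ω', X ω' ∂μ) μ := hX.sub aestronglyMeasurable_const
  have hY2 : MemLp (fun ω => |X ω - ∫ ω', X ω' ∂μ|) 2 μ :=
    (MemLp.of_bound hYm (B + |∫ ω', X ω' ∂μ|) (Eventually.of_forall fun ω => by
      rw [Real.norm_eq_abs]
      exact (abs_sub _ _).trans (add_le_add (hB ω) le_rfl))).abs
  have hYi : Integrable (fun ω => |X ω - ∫ ω', X ω' ∂μ|) μ := hY2.integrable one_le_two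
  -- Cauchy–Schwarz: `(E|X − EX|)² ≤ Var X`
  have hsq : (∫ ω, |X ω - ∫ ω', X ω' ∂μ| ∂μ) ^ 2 ≤ ProbabilityTheory.variance X μ := by
    have hv := ProbabilityTheory.variance_nonneg (fun ω => |X ω - ∫ ω', X ω' ∂μ|) μ
    rw [ProbabilityTheory.variance_eq_sub hY2] at hv
    simp only [Pi.pow_apply, sq_abs] at hv
    rw [ProbabilityTheory.variance_eq_integral hX.aemeasurable]
    linarith
  have h1 : ∫ ω, |X ω - ∫ ω', X ω' ∂μ| ∂μ ≤ Real.sqrt (ProbabilityTheory.variance X μ) :=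
    (le_abs_self _).trans (Real.abs_le_sqrt hsq)
  -- `|X| ≤ |X − EX| + |EX|`
  calc ∫ ω, |X ω| ∂μ ≤ ∫ ω, (|X ω - ∫ ω', X ω' ∂μ| + |∫ ω', X ω' ∂μ|) ∂μ := by
        refine integral_mono hXi.abs (hYi.add (integrable_const _)) fun ω => ?_
        have h := abs_add_le (X ω - ∫ ω', X ω' ∂μ) (∫ ω', X ω' ∂μ)
        rwa [sub_add_cancel] at h
    _ = (∫ ω, |X ω - ∫ ω', X ω' ∂μ| ∂μ) + |∫ ω', X ω' ∂μ| := by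
        rw [integral_add hYi (integrable_const _), integral_const, probReal_univ, one_smul]
    _ ≤ Real.sqrt (ProbabilityTheory.variance X μ) + |∫ ω, X ω ∂μ| := add_le_add h1 le_rfl
    _ = |∫ ω, X ω ∂μ| + Real.sqrt (ProbabilityTheory.variance X μ) := add_comm _ _

/-- **R34 · the time-integrated `L¹` smallness of the even tube functional at the unit mark, AT RUNG 0** (registered stub `stub_evenTubeStatL1Rung0` of crux stmt-AtomisticToContinuum-13481, line `Sketch`, skeleton v21): under the flow-invariant canonical law, `E|W_t ∘ Φ_t| ≤ |E W_t| + √Var(W_t ∘ Φ_t)` (`integral_abs_le_abs_integral_add_sqrt_variance`), the mean from `stub_meanEnskogUnitRung0`'s inputs pointwise in `t` (tube side `forall_abs_integral_tubeStat_sub_le_of_contact` on the tree contact theorem, Enskog side `tendsto_integral_enskogRate_rung0_of_psi` + dominated convergence in `t`), the variance from `fixedTimeVariance_unit_rung0_of_static` on `tubeVariance_unit_rung0_of_plateauWindow` (windowed plateau `plateauWindow_of_twoCluster_labelLaw`) and `enskogRateVariance_unit_rung0` at `ς = (η/(4τ))²`. [folklore] -/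
theorem stub_evenTubeStatL1Rung0 :
    ∃ η₀ : ℝ, 0 < η₀ ∧ ∀ (ab θb : ℝ) (ub : V3), 0 < ab → 0 < θb → ∃ σ₀ : ℝ, 0 < σ₀ ∧ ∀ σ : ℝ, 0 < σ → σ < σ₀ →
      ∀ Φ : (N : ℕ) → HardSphereFlow (Torus.geometry (Fin 3)) (hsDiameter σ N) (N + 1),
      ∀ τ : ℝ, 0 < τ → ∀ χ : ℝ × T3 → ℝ, Continuous χ → ∀ g : ℝ → ℝ, Continuous g →
      (∀ x, η₀ ≤ x → g x = 0) →
      ∀ η : ℝ, 0 < η → ∃ r₀ : ℝ, 0 < r₀ ∧ ∀ r : ℝ, 0 < r → r < r₀ →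
      ∀ L : ℝ, 1 ≤ L → ∃ κ₀ : ℝ, 0 < κ₀ ∧ ∀ κ : ℝ, 0 < κ → κ < κ₀ → ∃ N₀ : ℕ, ∀ N : ℕ, N₀ ≤ N →
        ∫ t in Set.Icc (0 : ℝ) τ,
            ∫ z, |evenTubeStat σ N χ g (fun q : V3 × V3 × V3 => speedCutoff L ‖q.2.2 - q.2.1‖) r κ t ((Φ N).flow t z)|
              ∂(localGibbsLaw σ (fun _ => ab) (fun _ => ub) (fun _ => θb) N (Φ N)) ≤ η := by
  -- adapted from `stub_meanEnskogUnitRung0` (Theorems/…CollisionRateMeanEnskogUnitRung0, p121619), with `|·|`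
  -- inside the time integral, plus the landed fixed-time variance of `collisionRateRung0`
  obtain ⟨η₆, hη₆, H6⟩ := evenTubeStatRegular_one
  -- the Enskog side: equation of state (analyticity radius `η'`), smallness `σ₄` of the uniform gas
  obtain ⟨η', hη', F, hF, hEq, -, -, -⟩ := hsEosLowDensity_JParityClosure
  obtain ⟨σ₄, hσ₄, hsmall⟩ := exists_smallDensity uniformProfile one_pos
  set η₄ : ℝ := η' / 2 with hη₄def
  have hη₄ : 0 < η₄ := by positivity
  obtain ⟨η₅, hη₅, σ₅, hσ₅, H5⟩ := forall_abs_integral_tubeStat_sub_le_of_contact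
    (contactStatementLG_of_contactTheorem Literature.MathematicalPhysics.StatisticalMechanics.HardSphereContactTheorem_holds)
  obtain ⟨ηY, hηY, HY⟩ := exists_bound_mul_contactValue hsEosLowDensity_JParityClosure
  -- the fixed-time variance at rung 0 (static assembly on the windowed plateau, as in `collisionRateRung0`)
  obtain ⟨ηV, hηV, HV⟩ := fixedTimeVariance_unit_rung0_of_static
    (tubeVariance_unit_rung0_of_plateauWindow
      (Summit.AtomisticToContinuum.HydrodynamicLimit.Theorems.EvenStressEnskog.plateauWindow_of_twoCluster_labelLaw
        Literature.MathematicalPhysics.KineticTheory.vcan_append_sub_mul_le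
        Literature.MathematicalPhysics.KineticTheory.integral_labelLaw_eq_integral_mul_vcan))
    enskogRateVariance_unit_rung0
  refine ⟨min (min (min (min η₄ η₅) η₆) ηY) ηV, lt_min (lt_min (lt_min (lt_min hη₄ hη₅) hη₆) hηY) hηV, ?_⟩
  intro a θ u ha hθ
  obtain ⟨σV, hσV, HV⟩ := HV a θ u ha hθ
  refine ⟨min (min (min σ₄ σ₅) (min (1 / 2) (min η₄ η₅))) σV,
    lt_min (lt_min (lt_min hσ₄ hσ₅) (lt_min (by norm_num) (lt_min hη₄ hη₅))) hσV, ?_⟩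
  intro σ hσ hσlt Φ τ hτ χ hχ g hg hg0 η hη
  -- thresholds
  have hσlt' : σ < min (min σ₄ σ₅) (min (1 / 2) (min η₄ η₅)) := lt_of_lt_of_le hσlt (min_le_left _ _)
  have hσV' : σ < σV := lt_of_lt_of_le hσlt (min_le_right _ _)
  have hσ4 : σ < σ₄ := lt_of_lt_of_le hσlt' ((min_le_left _ _).trans (min_le_left _ _))
  have hσ5 : σ < σ₅ := lt_of_lt_of_le hσlt' ((min_le_left _ _).trans (min_le_right _ _))
  have hσhalf : σ ≤ 1 / 2 := (lt_of_lt_of_le hσlt' ((min_le_right _ _).trans (min_le_left _ _))).le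
  have hση : σ < min η₄ η₅ := lt_of_lt_of_le hσlt' ((min_le_right _ _).trans (min_le_right _ _))
  have hσ3 : σ ^ 3 ≤ σ := pow_le_of_le_one hσ.le (by linarith) (by norm_num)
  have hσcube4 : σ ^ 3 < η₄ := lt_of_le_of_lt hσ3 (lt_of_lt_of_le hση (min_le_left _ _))
  have hσcube5 : σ ^ 3 < η₅ := lt_of_le_of_lt hσ3 (lt_of_lt_of_le hση (min_le_right _ _))
  have hg0' : ∀ b, min (min (min η₄ η₅) η₆) ηY ≤ b → g b = 0 := fun b hb =>
    hg0 b ((min_le_left _ _).trans hb)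
  have hg5 : ∀ b, η₅ ≤ b → g b = 0 := fun b hb =>
    hg0' b ((((min_le_left _ _).trans (min_le_left _ _)).trans (min_le_right _ _)).trans hb)
  have hg6 : ∀ b, η₆ ≤ b → g b = 0 := fun b hb =>
    hg0' b (((min_le_left _ _).trans (min_le_right _ _)).trans hb)
  have hgY : ∀ b, ηY ≤ b → g b = 0 := fun b hb => hg0' b ((min_le_right _ _).trans hb)
  have hgV : ∀ b, ηV ≤ b → g b = 0 := fun b hb => hg0 b ((min_le_right _ _).trans hb)
  obtain ⟨CgY, hCgY0, hCgY⟩ := HY g hg hgY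
  have hsd : SmallDensity uniformProfile σ := (hsmall σ hσ hσ4).1
  -- `ψ = g · Y` is continuous at `σ³ ∈ (0, η')` (`f_ex = F` analytic on the open band)
  have hψc : ContinuousAt (fun b => g b * contactValue b) (σ ^ 3) := by
    have hs : 0 < σ ^ 3 := pow_pos hσ 3
    have hs' : σ ^ 3 < η' := by rw [hη₄def] at hσcube4; linarith
    have hnhds : hsExcessFreeEnergy =ᶠ[𝓝 (σ ^ 3)] F :=
      Filter.eventuallyEq_of_mem (isOpen_Ioo.mem_nhds ⟨hs, hs'⟩) (hEq.mono Ioo_subset_Ico_self)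
    have hYF : (fun b => 3 / (2 * Real.pi) * deriv F b) =ᶠ[𝓝 (σ ^ 3)] contactValue :=
      hnhds.deriv.mono fun b hb => by rw [contactValue, hb]
    have hFc : ContinuousAt (deriv F) (σ ^ 3) :=
      hF.deriv.continuousOn.continuousAt (isOpen_Ioo.mem_nhds ⟨by linarith, hs'⟩)
    exact hg.continuousAt.mul ((hFc.const_mul _).congr hYF)
  -- a uniform bound for `χ` on `[0, τ] × 𝕋³`
  have hKc : IsCompact (Set.Icc (0 : ℝ) τ ×ˢ (univ : Set (UnitAddTorus (Fin 3)))) :=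
    isCompact_Icc.prod isCompact_univ
  obtain ⟨Cχ, hCχ⟩ := hKc.exists_bound_of_continuousOn hχ.continuousOn
  have hχb : ∀ t ∈ Set.Icc (0 : ℝ) τ, ∀ x, |χ (t, x)| ≤ Cχ := fun t ht x => by
    simpa only [Real.norm_eq_abs] using hCχ (t, x) ⟨ht, mem_univ _⟩
  -- the law
  set G : (N : ℕ) → Measure (Config (N + 1) (Fin 3) T3) :=
    fun N => localGibbsLaw σ (fun _ => a) (fun _ => u) (fun _ => θ) N (Φ N) with hG
  have hPN : ∀ N, IsProbabilityMeasure (G N) := fun N =>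
    isProbabilityMeasure_localGibbsLaw continuous_const continuous_const continuous_const
      (fun _ => ha) (fun _ => hθ) hσhalf N (Φ N)
  -- the variance input at `ς = (η / (4τ))²`
  have hς : 0 < (η / (4 * τ)) ^ 2 := by positivity
  obtain ⟨rV, hrV, HV⟩ := HV σ hσ hσV' Φ τ hτ χ hχ g hg hgV ((η / (4 * τ)) ^ 2) hς
  refine ⟨min (1 / 4) rV, lt_min (by norm_num) hrV, ?_⟩
  intro r hr hrlt L hL
  have hrlt4 : r < 1 / 4 := lt_of_lt_of_le hrlt (min_le_left _ _)
  have hrV' : r < rV := lt_of_lt_of_le hrlt (min_le_right _ _)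
  have hLpos : (0 : ℝ) < L := zero_lt_one.trans_le hL
  -- the mark `Ξ₁ᴸ`: continuous, bounded by `1 ≤ 2L`, vanishing at relative speed `≥ 2L`, `|Θ Ξ₁ᴸ| ≤ 2L|S²|`
  set Ξ : V3 × V3 × V3 → ℝ := fun q => speedCutoff L ‖q.2.2 - q.2.1‖ with hΞdef
  have hΞc : Continuous Ξ := continuous_speedCutoff_mark L
  have hΞb : ∀ p, |Ξ p| ≤ 2 * L := fun p => (abs_speedCutoff_le_one L _).trans (by linarith)
  have hΞL : ∀ m v v' : V3, 2 * L ≤ ‖v - v'‖ → Ξ (m, v, v') = 0 := fun m v v' h => by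
    rw [norm_sub_rev] at h
    exact speedCutoff_eq_zero hLpos h
  set CΘ : ℝ := 2 * L * sphereMass V3 with hCΘ
  have hΘle : ∀ v w, |sphereMark Ξ v w| ≤ CΘ := fun v w => abs_sphereMark_speedCutoff_le hLpos v w
  -- the uniform Enskog bound
  set CE : ℝ := Cχ * CgY * ((3 / (Real.pi * r ^ 3)) ^ 2 * CΘ) *
    (volume : Measure (UnitAddTorus (Fin 3))).real univ with hCE
  have hEbound : ∀ (N : ℕ), ∀ t ∈ Set.Icc (0 : ℝ) τ, ∀ z,
      |enskogRate σ N χ g Ξ r t z| ≤ CE := fun N t ht z =>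
    abs_enskogRate_le_of_abs_sphereMark_le_const (hχb t ht) hCgY hσ.le hΘle hr N z
  set Θb : ℝ := ∫ p : V3 × V3, sphereMark Ξ p.1 p.2 *
    (localMaxwellian 1 θ u p.1 * localMaxwellian 1 θ u p.2) with hΘb
  -- the Enskog mean `m_t = (∫χ(t,·)) g(σ³) Y(σ³) Θ̄`
  set mE : ℝ → ℝ := fun t => (∫ x : UnitAddTorus (Fin 3), χ (t, x)) * g (σ ^ 3) * contactValue (σ ^ 3) * Θb
    with hmE
  -- the tube side: H5 at accuracy `η/4`, uniformly on `[0, τ]`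
  obtain ⟨κ₅, hκ₅, H5'⟩ := H5 σ a θ u τ χ g L r Ξ hσ hσ5 hσcube5 ha hθ hτ hχ hg hg5 hL hr hrlt4 hΞc hΞb hΞL
    (η / 4) (by positivity)
  refine ⟨min κ₅ 1, lt_min hκ₅ one_pos, fun κ hκ hκlt => ?_⟩
  have hκ5 : κ < κ₅ := lt_of_lt_of_le hκlt (min_le_left _ _)
  have hκ1 : κ ≤ 1 := (lt_of_lt_of_le hκlt (min_le_right _ _)).le
  obtain ⟨N₅, hN₅⟩ := H5' κ hκ hκ5 Φ
  obtain ⟨NV, hNV⟩ := HV r hr hrV' L κ hL hκ hκ1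
  -- the Enskog side: H4 pointwise in `t`
  have h4t : ∀ t : ℝ, Tendsto (fun N : ℕ => ∫ z, enskogRate σ N χ g Ξ r t z ∂(G N)) atTop (𝓝 (mE t)) :=
    fun t => tendsto_integral_enskogRate_rung0_of_psi hsd ha hθ hχ hg hCgY hψc hΞc hΘle hr (by linarith) t Φ
  -- joint measurability of `(t, z) ↦ e_t(z)` for each `N` (via `e = σ⁻³ (A − W)`)
  have hmeasE : ∀ N, Measurable (fun p : ℝ × Config (N + 1) (Fin 3) T3 =>
      enskogRate σ N χ g Ξ r p.1 p.2) := by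
    intro N
    obtain ⟨hmeasW, -⟩ := H6 σ N χ g L r κ τ hσ hχ hg hg6 hLpos hr hκ.le
    have hmeasA := Summit.AtomisticToContinuum.HydrodynamicLimit.Theorems.measurable_tubeStat_uncurry σ N
      hχ hg hΞc r r 1 κ
    have hσ3ne : σ ^ 3 ≠ 0 := pow_ne_zero 3 hσ.ne'
    have heq : (fun p : ℝ × Config (N + 1) (Fin 3) T3 => enskogRate σ N χ g Ξ r p.1 p.2)
        = fun p => (σ ^ 3)⁻¹ * (tubeStat σ N χ g Ξ r r 1 κ p.1 p.2 -
            evenTubeStat σ N χ g Ξ r κ p.1 p.2) := by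
      funext p
      rw [evenTubeStat_def]
      field_simp
      ring
    rw [heq]
    exact (hmeasA.sub hmeasW).const_mul _
  -- the `t ↦ E e_t` are measurable and uniformly bounded on `[0, τ]`
  have hFmeas : ∀ N, AEStronglyMeasurable
      (fun t => ∫ z, enskogRate σ N χ g Ξ r t z ∂(G N))
      (volume.restrict (Set.Icc (0 : ℝ) τ)) := fun N =>
    ((hmeasE N).stronglyMeasurable.integral_prod_right' (ν := G N)).aestronglyMeasurable
  have hFbound : ∀ N, ∀ᵐ t ∂(volume.restrict (Set.Icc (0 : ℝ) τ)),
      ‖∫ z, enskogRate σ N χ g Ξ r t z ∂(G N)‖ ≤ CE := by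
    intro N
    haveI := hPN N
    filter_upwards [ae_restrict_mem measurableSet_Icc] with t ht
    have h := norm_integral_le_of_norm_le_const (μ := G N)
      (f := fun z => enskogRate σ N χ g Ξ r t z) (C := CE)
      (Eventually.of_forall fun z => by simpa only [Real.norm_eq_abs] using hEbound N t ht z)
    simpa only [probReal_univ, mul_one] using h
  -- the Enskog mean `t ↦ m_t` is integrable on `[0, τ]`
  have hmEi : Integrable mE (volume.restrict (Set.Icc (0 : ℝ) τ)) := by
    have h := ((integrableOn_integral_of_continuous hχ τ).integrable).mul_const
      (g (σ ^ 3) * contactValue (σ ^ 3) * Θb)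
    refine h.congr (Eventually.of_forall fun t => ?_)
    simp only [hmE]
    ring
  -- the deviations `|E e_t − m_t|`: measurable, dominated, pointwise null in the limit — hence `L¹([0, τ])`-null
  have hDmeas : ∀ N, AEStronglyMeasurable
      (fun t => |(∫ z, enskogRate σ N χ g Ξ r t z ∂(G N)) - mE t|)
      (volume.restrict (Set.Icc (0 : ℝ) τ)) := fun N =>
    continuous_abs.comp_aestronglyMeasurable ((hFmeas N).sub hmEi.aestronglyMeasurable)
  have hDbound : ∀ N, ∀ᵐ t ∂(volume.restrict (Set.Icc (0 : ℝ) τ)),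
      ‖|(∫ z, enskogRate σ N χ g Ξ r t z ∂(G N)) - mE t|‖ ≤ CE + ‖mE t‖ := by
    intro N
    filter_upwards [hFbound N] with t ht
    rw [Real.norm_eq_abs] at ht
    rw [Real.norm_eq_abs, Real.norm_eq_abs, abs_abs]
    exact (abs_sub _ _).trans (add_le_add ht le_rfl)
  have hDCT : Tendsto (fun N : ℕ => ∫ t in Set.Icc (0 : ℝ) τ,
      |(∫ z, enskogRate σ N χ g Ξ r t z ∂(G N)) - mE t|) atTop (𝓝 0) := by
    have h := tendsto_integral_of_dominated_convergence (μ := volume.restrict (Set.Icc (0 : ℝ) τ))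
      (F := fun (N : ℕ) (t : ℝ) => |(∫ z, enskogRate σ N χ g Ξ r t z ∂(G N)) - mE t|)
      (f := fun _ => (0 : ℝ)) (fun t => CE + ‖mE t‖) hDmeas ((integrable_const CE).add hmEi.norm) hDbound
      (Eventually.of_forall fun t => by
        have h := ((h4t t).sub_const (mE t)).abs
        rwa [sub_self, abs_zero] at h)
    simpa only [integral_zero] using h
  have hσ3pos : 0 < σ ^ 3 := pow_pos hσ 3
  obtain ⟨N₄, hN₄⟩ := Metric.tendsto_atTop.1 hDCT (η / 4 / σ ^ 3) (by positivity)
  refine ⟨max (max N₄ N₅) NV, fun N hN => ?_⟩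
  have hN4' := hN₄ N (((le_max_left _ _).trans (le_max_left _ _)).trans hN)
  have hN5' := hN₅ N (((le_max_right _ _).trans (le_max_left _ _)).trans hN)
  have hNV' := hNV N ((le_max_right _ _).trans hN)
  haveI := hPN N
  -- regularity of `W` (S6) and `A` (tree) for this `N`
  obtain ⟨hmeasW, BW, hBW⟩ := H6 σ N χ g L r κ τ hσ hχ hg hg6 hLpos hr hκ.le
  have hmeasA := Summit.AtomisticToContinuum.HydrodynamicLimit.Theorems.measurable_tubeStat_uncurry σ N
    hχ hg hΞc r r 1 κ
  obtain ⟨BA, hBA⟩ := Summit.AtomisticToContinuum.HydrodynamicLimit.Theorems.exists_bound_tubeStat σ N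
    hχ hg ⟨2 * L, hΞb⟩ hr r zero_le_one hκ.le τ
  have hmeasWt : ∀ t, Measurable (fun z => evenTubeStat σ N χ g Ξ r κ t z) :=
    fun t => Measurable.of_uncurry_left
      (f := fun (t : ℝ) (z : Config (N + 1) (Fin 3) T3) => evenTubeStat σ N χ g Ξ r κ t z)
      hmeasW
  have hmeasAt : ∀ t, Measurable (fun z => tubeStat σ N χ g Ξ r r 1 κ t z) :=
    fun t => Measurable.of_uncurry_left
      (f := fun (t : ℝ) (z : Config (N + 1) (Fin 3) T3) => tubeStat σ N χ g Ξ r r 1 κ t z)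
      hmeasA
  have hmeasEt : ∀ t, Measurable (fun z => enskogRate σ N χ g Ξ r t z) :=
    fun t => Measurable.of_uncurry_left
      (f := fun (t : ℝ) (z : Config (N + 1) (Fin 3) T3) => enskogRate σ N χ g Ξ r t z)
      (hmeasE N)
  -- stationarity: the flow disappears under the Gibbs mean
  have hstat : ∀ t, ∫ z, evenTubeStat σ N χ g Ξ r κ t ((Φ N).flow t z) ∂(G N)
      = ∫ z, evenTubeStat σ N χ g Ξ r κ t z ∂(G N) := fun t =>
    integral_comp_flow_localGibbsLaw_const σ a θ u N (Φ N) t (hmeasWt t).aestronglyMeasurable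
  -- decomposition of the static mean at each `t ∈ [0, τ]`
  have hdec : ∀ t ∈ Set.Icc (0 : ℝ) τ,
      ∫ z, evenTubeStat σ N χ g Ξ r κ t z ∂(G N)
        = (∫ z, tubeStat σ N χ g Ξ r r 1 κ t z ∂(G N))
          - σ ^ 3 * ∫ z, enskogRate σ N χ g Ξ r t z ∂(G N) := by
    intro t ht
    have hiA : Integrable (fun z => tubeStat σ N χ g Ξ r r 1 κ t z) (G N) :=
      Integrable.of_bound (hmeasAt t).aestronglyMeasurable BA
        (Eventually.of_forall fun z => by simpa only [Real.norm_eq_abs] using hBA t ht z)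
    have hiE : Integrable (fun z => σ ^ 3 * enskogRate σ N χ g Ξ r t z) (G N) :=
      (Integrable.of_bound (hmeasEt t).aestronglyMeasurable CE
        (Eventually.of_forall fun z => by
          simpa only [Real.norm_eq_abs] using hEbound N t ht z)).const_mul _
    simp_rw [evenTubeStat_def]
    rw [integral_sub hiA hiE, integral_const_mul]
  -- the pointwise-in-`t` bound: `E|W_t ∘ Φ_t| ≤ η/(4τ) + σ³ |E e_t − m_t| + η/(4τ)`
  have hpt : ∀ t ∈ Set.Icc (0 : ℝ) τ,
      ∫ z, |evenTubeStat σ N χ g Ξ r κ t ((Φ N).flow t z)| ∂(G N)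
        ≤ η / (4 * τ) + σ ^ 3 * |(∫ z, enskogRate σ N χ g Ξ r t z ∂(G N)) - mE t| + η / (4 * τ) := by
    intro t ht
    have hWf : AEStronglyMeasurable (fun z => evenTubeStat σ N χ g Ξ r κ t ((Φ N).flow t z)) (G N) :=
      ((hmeasWt t).comp ((Φ N).measurable_flow t)).aestronglyMeasurable
    have h1 := integral_abs_le_abs_integral_add_sqrt_variance hWf (fun z => hBW t ht ((Φ N).flow t z))
    -- the mean
    have hmean : |∫ z, evenTubeStat σ N χ g Ξ r κ t ((Φ N).flow t z) ∂(G N)|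
        ≤ η / (4 * τ) + σ ^ 3 * |(∫ z, enskogRate σ N χ g Ξ r t z ∂(G N)) - mE t| := by
      rw [hstat t, hdec t ht]
      have e : (∫ z, tubeStat σ N χ g Ξ r r 1 κ t z ∂(G N)) - σ ^ 3 * ∫ z, enskogRate σ N χ g Ξ r t z ∂(G N)
          = ((∫ z, tubeStat σ N χ g Ξ r r 1 κ t z ∂(G N))
              - σ ^ 3 * g (σ ^ 3) * contactValue (σ ^ 3) * Θb * ∫ x : UnitAddTorus (Fin 3), χ (t, x))
            - σ ^ 3 * ((∫ z, enskogRate σ N χ g Ξ r t z ∂(G N)) - mE t) := by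
        simp only [hmE]
        ring
      rw [e]
      calc |((∫ z, tubeStat σ N χ g Ξ r r 1 κ t z ∂(G N))
              - σ ^ 3 * g (σ ^ 3) * contactValue (σ ^ 3) * Θb * ∫ x : UnitAddTorus (Fin 3), χ (t, x))
            - σ ^ 3 * ((∫ z, enskogRate σ N χ g Ξ r t z ∂(G N)) - mE t)|
          ≤ |(∫ z, tubeStat σ N χ g Ξ r r 1 κ t z ∂(G N))
              - σ ^ 3 * g (σ ^ 3) * contactValue (σ ^ 3) * Θb * ∫ x : UnitAddTorus (Fin 3), χ (t, x)|
            + |σ ^ 3 * ((∫ z, enskogRate σ N χ g Ξ r t z ∂(G N)) - mE t)| := abs_sub _ _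
        _ = |(∫ z, tubeStat σ N χ g Ξ r r 1 κ t z ∂(G N))
              - σ ^ 3 * g (σ ^ 3) * contactValue (σ ^ 3) * Θb * ∫ x : UnitAddTorus (Fin 3), χ (t, x)|
            + σ ^ 3 * |(∫ z, enskogRate σ N χ g Ξ r t z ∂(G N)) - mE t| := by
            rw [abs_mul, abs_of_pos hσ3pos]
        _ ≤ η / 4 / τ + σ ^ 3 * |(∫ z, enskogRate σ N χ g Ξ r t z ∂(G N)) - mE t| :=
            add_le_add (hN5' t ht) le_rfl
        _ = η / (4 * τ) + σ ^ 3 * |(∫ z, enskogRate σ N χ g Ξ r t z ∂(G N)) - mE t| := by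
            rw [div_div]
    -- the variance
    have hvar : Real.sqrt (ProbabilityTheory.variance
        (fun z => evenTubeStat σ N χ g Ξ r κ t ((Φ N).flow t z)) (G N)) ≤ η / (4 * τ) :=
      (Real.sqrt_le_sqrt (hNV' t ht)).trans (le_of_eq (Real.sqrt_sq (by positivity)))
    exact h1.trans (add_le_add hmean hvar)
  -- integrate in `t ∈ [0, τ]`
  have hDi : Integrable (fun t => |(∫ z, enskogRate σ N χ g Ξ r t z ∂(G N)) - mE t|)
      (volume.restrict (Set.Icc (0 : ℝ) τ)) :=
    ((integrable_const CE).add hmEi.norm).mono' (hDmeas N) (hDbound N)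
  have hDi' : Integrable (fun t => σ ^ 3 * |(∫ z, enskogRate σ N χ g Ξ r t z ∂(G N)) - mE t|)
      (volume.restrict (Set.Icc (0 : ℝ) τ)) := hDi.const_mul _
  have hci : Integrable (fun _ : ℝ => η / (4 * τ)) (volume.restrict (Set.Icc (0 : ℝ) τ)) := integrable_const _
  have h12 : Integrable (fun t => η / (4 * τ) + σ ^ 3 * |(∫ z, enskogRate σ N χ g Ξ r t z ∂(G N)) - mE t|)
      (volume.restrict (Set.Icc (0 : ℝ) τ)) := hci.add hDi'
  have hint : ∫ t in Set.Icc (0 : ℝ) τ, |(∫ z, enskogRate σ N χ g Ξ r t z ∂(G N)) - mE t| < η / 4 / σ ^ 3 := by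
    have h := hN4'
    rw [Real.dist_eq, sub_zero] at h
    exact (abs_lt.1 h).2
  calc ∫ t in Set.Icc (0 : ℝ) τ, ∫ z, |evenTubeStat σ N χ g Ξ r κ t ((Φ N).flow t z)| ∂(G N)
      ≤ ∫ t in Set.Icc (0 : ℝ) τ,
          (η / (4 * τ) + σ ^ 3 * |(∫ z, enskogRate σ N χ g Ξ r t z ∂(G N)) - mE t| + η / (4 * τ)) :=
        integral_mono_of_nonneg (Eventually.of_forall fun t => integral_nonneg fun z => abs_nonneg _)
          (h12.add hci) ((ae_restrict_mem measurableSet_Icc).mono fun t ht => hpt t ht)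
    _ = τ * (η / (4 * τ)) + σ ^ 3 * (∫ t in Set.Icc (0 : ℝ) τ,
          |(∫ z, enskogRate σ N χ g Ξ r t z ∂(G N)) - mE t|) + τ * (η / (4 * τ)) := by
        rw [integral_add h12 hci, integral_add hci hDi', integral_const_mul, setIntegral_const,
          Real.volume_real_Icc_of_le hτ.le, sub_zero, smul_eq_mul]
    _ ≤ η := by
        have hc4 : τ * (η / (4 * τ)) = η / 4 := by
          rw [mul_comm, div_mul_eq_mul_div, mul_div_mul_right _ _ hτ.ne']
        have hcE : σ ^ 3 * (η / 4 / σ ^ 3) = η / 4 := by field_simp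
        have hE4 : σ ^ 3 * (∫ t in Set.Icc (0 : ℝ) τ,
            |(∫ z, enskogRate σ N χ g Ξ r t z ∂(G N)) - mE t|) ≤ η / 4 := by
          have h := mul_le_mul_of_nonneg_left hint.le hσ3pos.le
          rwa [hcE] at h
        rw [hc4]
        linarith

end Summit.AtomisticToContinuum.HydrodynamicLimit.Theorems.CollisionRate
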